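import Literature.Computability.AlgebraicComplexity.PatternExpressions
import Summits.ValiantsHypothesis.ValiantsHypothesis.Theorems.MonotoneRestorationOrbitRestorationQPHereditaryTerms
import HarnessLib

/-!
# Unfolding a labelled pattern expression into hereditary normal terms

Route MonotoneRestoration, crux `OrbitRestorationQP` (stmt-ValiantsHypothesis-18293) — K3, namespace
`Summit.ValiantsHypothesis.ValiantsHypothesis.Theorems.PatternClose`.  For a labelled pattern expression `e`
(`PatternExpressions.lean`, Dawar–Pago–Seppelt's bipartite graph algebra) and a label assignment
`(ρ, γ)` on the `n × n` matrix, `unfold n e ρ γ` is the hereditary `{+, ×}`-term of the computation of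
`value n e ρ γ` (one node per operation; the `n` instances of a summed-out label are the `n` children of a
sum node) and `nf n e ρ γ` its NORMAL form (`…MonotoneRestorationOrbitRestorationQPHereditaryTerms.lean`).

* `val_unfold`, `val_nf` — the (normal) unfolding computes `value n e ρ γ`;
* `normalize_rename_unfold`, `act_nf` — EQUIVARIANCE: renaming the variables diagonally by
  `σ ∈ Sym(Fin n)` and renormalising is relabelling the assignment by `σ` (the children of a summed-out
  label are permuted, which the normal form absorbs: `Equiv.Perm.ofFn_comp_perm`);
* `subexprs`, `exists_of_mem_nf_children`, `length_eq_two_of_nf_eq_node_true`,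
  `length_of_nf_eq_node_false` — the children of a normal unfolding are normal unfoldings of immediate
  sub-expressions; product nodes are binary, sum nodes have `2` or `n` children.

Everything is proved. [folklore]

## References
* A. Dawar, B. Pago, T. Seppelt, *Symmetric algebraic circuits and homomorphism polynomials*,
  arXiv:2502.06740 (2025), §5. [DawarPagoSeppelt2025]
* A. Dawar, G. Wilsenach, *Symmetric arithmetic circuits*, ToC 21 (2025), Def. 2.2, §3.3.
  [DawarWilsenach2025]
-/

noncomputable section

open scoped Classical

-- `Summit.ValiantsHypothesis.ValiantsHypothesis.…` is the tree's single-conjunct layout (Sub = Summit).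
set_option linter.dupNamespace false

namespace Summit.ValiantsHypothesis.ValiantsHypothesis.Theorems

open Literature.Computability.AlgebraicComplexity

namespace PatternClose

open PatternExpr (value close value_sumRow value_sumCol value_add value_mul value_edge value_const)

open HTerm

variable {R : Type} [CommSemiring R] {k l : ℕ}

/-! ### Unfolding a pattern expression at a label assignment into a hereditary term -/

/-- The raw unfolding of an expression at an assignment: one term node per operation, the `n`
instances of a summed-out label as the `n` children of a sum node. [folklore] -/
def unfold (n : ℕ) : PatternExpr R k l → (Fin k → Fin n) → (Fin l → Fin n) → HTerm R (Fin n × Fin n)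
  | .edge a b, ρ, γ => HTerm.var (ρ a, γ b)
  | .const c, _, _ => HTerm.const c
  | .add e₁ e₂, ρ, γ => HTerm.node false [unfold n e₁ ρ γ, unfold n e₂ ρ γ]
  | .mul e₁ e₂, ρ, γ => HTerm.node true [unfold n e₁ ρ γ, unfold n e₂ ρ γ]
  | .sumRow a e, ρ, γ => HTerm.node false (List.ofFn fun v : Fin n => unfold n e (Function.update ρ a v) γ)
  | .sumCol b e, ρ, γ => HTerm.node false (List.ofFn fun v : Fin n => unfold n e ρ (Function.update γ b v))

/-- **The unfolding computes the value.** [folklore] -/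
theorem val_unfold (n : ℕ) (e : PatternExpr R k l) :
    ∀ (ρ : Fin k → Fin n) (γ : Fin l → Fin n), (unfold n e ρ γ).val = value n e ρ γ := by
  induction e with
  | edge a b => intro ρ γ; simp [unfold]
  | const c => intro ρ γ; simp [unfold]
  | add e₁ e₂ ih₁ ih₂ => intro ρ γ; simp [unfold, val_node_false, ih₁, ih₂]
  | mul e₁ e₂ ih₁ ih₂ => intro ρ γ; simp [unfold, val_node_true, ih₁, ih₂]
  | sumRow a e ih =>
    intro ρ γ
    rw [unfold, val_node_false, List.map_ofFn, List.sum_ofFn, value_sumRow]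
    exact Finset.sum_congr rfl fun v _ => ih _ _
  | sumCol b e ih =>
    intro ρ γ
    rw [unfold, val_node_false, List.map_ofFn, List.sum_ofFn, value_sumCol]
    exact Finset.sum_congr rfl fun v _ => ih _ _

/-- The NORMAL unfolding (hereditarily AC-canonical). [folklore] -/
def nf (n : ℕ) (e : PatternExpr R k l) (ρ : Fin k → Fin n) (γ : Fin l → Fin n) :
    HTerm R (Fin n × Fin n) :=
  normalize (unfold n e ρ γ)

omit [CommSemiring R] in
/-- The normal unfolding is normal. [folklore] -/
theorem normalize_nf (n : ℕ) (e : PatternExpr R k l) (ρ : Fin k → Fin n) (γ : Fin l → Fin n) :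
    normalize (nf n e ρ γ) = nf n e ρ γ :=
  normalize_normalize _

/-- The normal unfolding computes the value. [folklore] -/
theorem val_nf (n : ℕ) (e : PatternExpr R k l) (ρ : Fin k → Fin n) (γ : Fin l → Fin n) :
    (nf n e ρ γ).val = value n e ρ γ := by
  rw [nf, val_normalize, val_unfold]

omit [CommSemiring R] in
/-- **Equivariance of the normal unfolding**: renaming the variables diagonally by `σ` and
renormalising is relabelling the assignment. [folklore] -/
theorem normalize_rename_unfold (n : ℕ) (σ : Equiv.Perm (Fin n)) (e : PatternExpr R k l) :
    ∀ (ρ : Fin k → Fin n) (γ : Fin l → Fin n),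
      normalize (HTerm.rename (fun pq : Fin n × Fin n => σ • pq) (unfold n e ρ γ)) =
        nf n e (σ ∘ ρ) (σ ∘ γ) := by
  induction e with
  | edge a b => intro ρ γ; rfl
  | const c => intro ρ γ; rfl
  | add e₁ e₂ ih₁ ih₂ =>
    intro ρ γ
    rw [unfold, rename_node, nf, unfold]
    refine normalize_node_congr false ?_
    simp only [List.map_cons, List.map_nil, ih₁, ih₂, nf]
  | mul e₁ e₂ ih₁ ih₂ =>
    intro ρ γ
    rw [unfold, rename_node, nf, unfold]
    refine normalize_node_congr true ?_
    simp only [List.map_cons, List.map_nil, ih₁, ih₂, nf]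
  | sumRow a e ih =>
    intro ρ γ
    rw [unfold, rename_node, nf, unfold, List.map_ofFn]
    have h1 : normalize (HTerm.node false (List.ofFn ((HTerm.rename fun pq : Fin n × Fin n => σ • pq) ∘
        fun v => unfold n e (Function.update ρ a v) γ))) =
        normalize (HTerm.node false (List.ofFn ((fun v =>
          nf n e (Function.update (σ ∘ ρ) a v) (σ ∘ γ)) ∘ σ))) := by
      refine normalize_node_congr false ?_
      rw [List.map_ofFn, List.map_ofFn]
      congr 1
      funext v
      simp only [Function.comp, ih, nf, normalize_normalize, Function.comp_update]
    rw [h1, normalize_node_perm false (Equiv.Perm.ofFn_comp_perm σ _)]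
    refine normalize_node_congr false ?_
    rw [List.map_ofFn, List.map_ofFn]
    congr 1
    funext v
    simp only [Function.comp, nf, normalize_normalize]
  | sumCol b e ih =>
    intro ρ γ
    rw [unfold, rename_node, nf, unfold, List.map_ofFn]
    have h1 : normalize (HTerm.node false (List.ofFn ((HTerm.rename fun pq : Fin n × Fin n => σ • pq) ∘
        fun v => unfold n e ρ (Function.update γ b v)))) =
        normalize (HTerm.node false (List.ofFn ((fun v =>
          nf n e (σ ∘ ρ) (Function.update (σ ∘ γ) b v)) ∘ σ))) := by
      refine normalize_node_congr false ?_
      rw [List.map_ofFn, List.map_ofFn]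
      congr 1
      funext v
      simp only [Function.comp, ih, nf, normalize_normalize, Function.comp_update]
    rw [h1, normalize_node_perm false (Equiv.Perm.ofFn_comp_perm σ _)]
    refine normalize_node_congr false ?_
    rw [List.map_ofFn, List.map_ofFn]
    congr 1
    funext v
    simp only [Function.comp, nf, normalize_normalize]

omit [CommSemiring R] in
/-- The action on normal unfoldings relabels the assignment. [folklore] -/
theorem act_nf (n : ℕ) (σ : Equiv.Perm (Fin n)) (e : PatternExpr R k l) (ρ : Fin k → Fin n)
    (γ : Fin l → Fin n) : act σ (nf n e ρ γ) = nf n e (σ • ρ) (σ • γ) := by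
  rw [nf, act_normalize, act]
  exact normalize_rename_unfold n σ e ρ γ

/-! ### Sub-expressions -/

/-- The list of sub-expressions (with the expression itself). [folklore] -/
def subexprs : PatternExpr R k l → List (PatternExpr R k l)
  | .edge a b => [.edge a b]
  | .const c => [.const c]
  | .add e₁ e₂ => .add e₁ e₂ :: (subexprs e₁ ++ subexprs e₂)
  | .mul e₁ e₂ => .mul e₁ e₂ :: (subexprs e₁ ++ subexprs e₂)
  | .sumRow a e => .sumRow a e :: subexprs e
  | .sumCol b e => .sumCol b e :: subexprs e

omit [CommSemiring R] in
/-- An expression is its own sub-expression. [folklore] -/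
theorem self_mem_subexprs (e : PatternExpr R k l) : e ∈ subexprs e := by
  cases e <;> simp [subexprs]

omit [CommSemiring R] in
/-- Sub-expressions of sub-expressions are sub-expressions. [folklore] -/
theorem subexprs_trans {e s s' : PatternExpr R k l} (hs : s ∈ subexprs e) (hs' : s' ∈ subexprs s) :
    s' ∈ subexprs e := by
  induction e with
  | edge a b => simp only [subexprs, List.mem_singleton] at hs; subst hs; exact hs'
  | const c => simp only [subexprs, List.mem_singleton] at hs; subst hs; exact hs'
  | add e₁ e₂ ih₁ ih₂ =>
    simp only [subexprs, List.mem_cons, List.mem_append] at hs ⊢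
    rcases hs with rfl | h | h
    · simpa [subexprs] using hs'
    · exact Or.inr (Or.inl (ih₁ h))
    · exact Or.inr (Or.inr (ih₂ h))
  | mul e₁ e₂ ih₁ ih₂ =>
    simp only [subexprs, List.mem_cons, List.mem_append] at hs ⊢
    rcases hs with rfl | h | h
    · simpa [subexprs] using hs'
    · exact Or.inr (Or.inl (ih₁ h))
    · exact Or.inr (Or.inr (ih₂ h))
  | sumRow a e ih =>
    simp only [subexprs, List.mem_cons] at hs ⊢
    rcases hs with rfl | h
    · simpa [subexprs] using hs'
    · exact Or.inr (ih h)
  | sumCol b e ih =>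
    simp only [subexprs, List.mem_cons] at hs ⊢
    rcases hs with rfl | h
    · simpa [subexprs] using hs'
    · exact Or.inr (ih h)

omit [CommSemiring R] in
/-- **Children of a normal unfolding are normal unfoldings of immediate sub-expressions.**
[folklore] -/
theorem exists_of_mem_nf_children (n : ℕ) (s : PatternExpr R k l) (ρ : Fin k → Fin n)
    (γ : Fin l → Fin n) {b : Bool} {L : List (HTerm R (Fin n × Fin n))}
    (h : nf n s ρ γ = HTerm.node b L) {u : HTerm R (Fin n × Fin n)} (hu : u ∈ L) :
    ∃ s' ∈ subexprs s, ∃ (ρ' : Fin k → Fin n) (γ' : Fin l → Fin n), u = nf n s' ρ' γ' := by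
  cases s with
  | edge a b' => simp [nf, unfold] at h
  | const c => simp [nf, unfold] at h
  | add e₁ e₂ =>
    rw [nf, unfold, normalize_node] at h
    simp only [HTerm.node.injEq] at h
    rw [← h.2] at hu
    have hu' := (tsort_perm _).subset hu
    simp only [List.map_cons, List.map_nil, List.mem_cons, List.not_mem_nil, or_false] at hu'
    rcases hu' with rfl | rfl
    · exact ⟨e₁, by simp [subexprs, self_mem_subexprs], ρ, γ, rfl⟩
    · exact ⟨e₂, by simp [subexprs, self_mem_subexprs], ρ, γ, rfl⟩
  | mul e₁ e₂ =>
    rw [nf, unfold, normalize_node] at h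
    simp only [HTerm.node.injEq] at h
    rw [← h.2] at hu
    have hu' := (tsort_perm _).subset hu
    simp only [List.map_cons, List.map_nil, List.mem_cons, List.not_mem_nil, or_false] at hu'
    rcases hu' with rfl | rfl
    · exact ⟨e₁, by simp [subexprs, self_mem_subexprs], ρ, γ, rfl⟩
    · exact ⟨e₂, by simp [subexprs, self_mem_subexprs], ρ, γ, rfl⟩
  | sumRow a e =>
    rw [nf, unfold, normalize_node] at h
    simp only [HTerm.node.injEq] at h
    rw [← h.2] at hu
    have hu' := (tsort_perm _).subset hu
    rw [List.map_ofFn, List.mem_ofFn] at hu'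
    obtain ⟨v, rfl⟩ := hu'
    exact ⟨e, by simp [subexprs, self_mem_subexprs], _, _, rfl⟩
  | sumCol b' e =>
    rw [nf, unfold, normalize_node] at h
    simp only [HTerm.node.injEq] at h
    rw [← h.2] at hu
    have hu' := (tsort_perm _).subset hu
    rw [List.map_ofFn, List.mem_ofFn] at hu'
    obtain ⟨v, rfl⟩ := hu'
    exact ⟨e, by simp [subexprs, self_mem_subexprs], _, _, rfl⟩

omit [CommSemiring R] in
/-- A product node among normal unfoldings is binary. [folklore] -/
theorem length_eq_two_of_nf_eq_node_true (n : ℕ) (s : PatternExpr R k l) (ρ : Fin k → Fin n)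
    (γ : Fin l → Fin n) {L : List (HTerm R (Fin n × Fin n))} (h : nf n s ρ γ = HTerm.node true L) :
    L.length = 2 := by
  cases s with
  | edge a b' => simp [nf, unfold] at h
  | const c => simp [nf, unfold] at h
  | add e₁ e₂ => rw [nf, unfold, normalize_node] at h; simp at h
  | mul e₁ e₂ =>
    rw [nf, unfold, normalize_node] at h
    simp only [HTerm.node.injEq, true_and] at h
    rw [← h, (tsort_perm _).length_eq]; simp
  | sumRow a e => rw [nf, unfold, normalize_node] at h; simp at h
  | sumCol b' e => rw [nf, unfold, normalize_node] at h; simp at h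

omit [CommSemiring R] in
/-- A sum node among normal unfoldings has `2` or `n` children. [folklore] -/
theorem length_of_nf_eq_node_false (n : ℕ) (s : PatternExpr R k l) (ρ : Fin k → Fin n)
    (γ : Fin l → Fin n) {L : List (HTerm R (Fin n × Fin n))} (h : nf n s ρ γ = HTerm.node false L) :
    L.length = 2 ∨ L.length = n := by
  cases s with
  | edge a b' => simp [nf, unfold] at h
  | const c => simp [nf, unfold] at h
  | add e₁ e₂ =>
    rw [nf, unfold, normalize_node] at h
    simp only [HTerm.node.injEq, true_and] at h
    rw [← h, (tsort_perm _).length_eq]; simp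
  | mul e₁ e₂ => rw [nf, unfold, normalize_node] at h; simp at h
  | sumRow a e =>
    rw [nf, unfold, normalize_node] at h
    simp only [HTerm.node.injEq, true_and] at h
    rw [← h, (tsort_perm _).length_eq]; simp
  | sumCol b' e =>
    rw [nf, unfold, normalize_node] at h
    simp only [HTerm.node.injEq, true_and] at h
    rw [← h, (tsort_perm _).length_eq]; simp

end PatternClose

end Summit.ValiantsHypothesis.ValiantsHypothesis.Theorems

end
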